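import Mathlib.Analysis.SpecialFunctions.Log.Basic
import Mathlib.Analysis.SpecialFunctions.Pow.Real
import HarnessLib

/-!
# Far-edge descent, kernel XL-B₁ — one-step inequalities of the chain potential

Step lemmas for `FarEdgeDescentChainCap` (kernel XL-B, memo NODE-g60): the floor-projected β-dial of
kernels XXXVIII/XXXIX in share coordinates.  A node of the dial carries a share
`λ = L/(Q+βL) ∈ (0, λ*]`, `λ* = 1/(2β−1)` (anchor ratio `ρ = Q/L = 1/λ − β ≥ β − 1` on the heavy
side), a NARROWNESS `V ∈ [0,1]` (the z-transform of its width profile, kernel XL-A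
`FarEdgeDescentWidthTransform`), a first-order deviation `y > 0` and a size `ℓ > 0`.  The two moves:
* squaring: `λ' = 2λ − (2β−1)λ²`, `V' = (2(1−βλ)V + zλV²)/(2 − (2β−1)λ)`, `y' = 2(1−(β−1)λ)y`,
  `ℓ' = 2ℓ`;
* base step (base share `μ ∈ (0, λ*]`, base deviation `0 ≤ y_b ≤ Rμ`): `λ' = λ + μ − (2β−1)λμ`,
  `V'λ' = μ(1−βλ) + λ(1−βμ)V + zλμV`, `y' = (1−(β−1)μ)y + (1−(β−1)λ)y_b`, `ℓ' ≥ ℓ`.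
The potential is `Ψ = log y − κ_S·log ℓ − log λ − γ·log(1 − min(V, V†))`, `κ_S = log(4/3)/log 2`.

Proved here: the squaring gain `2(1−(β−1)λ)/(2−(2β−1)λ)` is at most `2β/(2β−1)`
(`gain_le_corner`) and at most `4/3` below the share `1/(β+1)` (`gain_le_four_thirds`); squaring
never increases narrowness (`Vsq_le`) and, above the share `1/(β+1)`, lands below the universal cut
`(2+z)/3` (`Vsq_le_cut`); the base-step key inequality `λ'(1−V') ≥ λ(1−(β−1)μ)(1−V)`
(`base_step_key`: replenishing narrowness is never cheaper than the damping it costs); and the two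
potential steps `square_step_potential` (under the SQUARING CRITERION hypothesis and the cut-off
conditions on `V†`) and `base_step_potential` (once `y ≥ Y₀ = R(2β−1)/(β(1−γ)(β−1))`).

HONEST FRAMING: MODEL level — real inequalities about the dial's clauses; nothing about tensors or
`ω`; no `sorry`, no new axioms, no definitions.  References: Schönhage 1981 [Schonhage1981];
Coppersmith–Winograd 1982 [CoppersmithWinograd1982]; kernels XXXVIII-B, XXXIX-J (`deviation_linear_step`).
-/

noncomputable section

set_option linter.dupNamespace false

namespace Summit.MatrixMultiplication.MatrixMultiplication.Theorems.FarEdgeDescentChainCapSteps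

/-! ## Elementary facts about the squaring map of the dial -/

/-- The squaring gain is monotone: `2(1−(β−1)λ)/(2−(2β−1)λ) ≤ 2β/(2β−1)` on the window
`(2β−1)λ ≤ 1` (equality at the fixed share `λ* = 1/(2β−1)`). -/
theorem gain_le_corner {β lam : ℝ} (hβ : 1 < β) (hlam : (2 * β - 1) * lam ≤ 1) :
    2 * (1 - (β - 1) * lam) / (2 - (2 * β - 1) * lam) ≤ 2 * β / (2 * β - 1) := by
  have hD : 0 < 2 - (2 * β - 1) * lam := by linarith
  have hB : 0 < 2 * β - 1 := by linarith
  rw [div_le_div_iff₀ hD hB]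
  nlinarith

/-- Below the share `1/(β+1)` a squaring gains nothing against `κ_S`:
`2(1−(β−1)λ)/(2−(2β−1)λ) ≤ 4/3` iff `(β+1)λ ≤ 1`. -/
theorem gain_le_four_thirds {β lam : ℝ} (hlam : (2 * β - 1) * lam ≤ 1)
    (hsmall : (β + 1) * lam ≤ 1) :
    2 * (1 - (β - 1) * lam) / (2 - (2 * β - 1) * lam) ≤ 4 / 3 := by
  have hD : 0 < 2 - (2 * β - 1) * lam := by linarith
  rw [div_le_div_iff₀ hD (by norm_num : (0:ℝ) < 3)]
  nlinarith

/-- The squared narrowness never exceeds the old one (`zV ≤ 1`). -/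
theorem Vsq_le {β z lam V : ℝ} (hz1 : z ≤ 1) (hlam0 : 0 ≤ lam)
    (hlam : (2 * β - 1) * lam ≤ 1) (hV0 : 0 ≤ V) (hV1 : V ≤ 1) :
    (2 * (1 - β * lam) * V + z * lam * V ^ 2) / (2 - (2 * β - 1) * lam) ≤ V := by
  have hD : 0 < 2 - (2 * β - 1) * lam := by linarith
  rw [div_le_iff₀ hD]
  have : z * lam * V ^ 2 ≤ lam * V := by
    have h1 : z * V ≤ 1 := by nlinarith
    have : z * lam * V ^ 2 = (z * V) * (lam * V) := by ring
    rw [this]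
    have hlv : 0 ≤ lam * V := mul_nonneg hlam0 hV0
    nlinarith
  nlinarith

/-- The squared narrowness is nonnegative. -/
theorem Vsq_nonneg {β z lam V : ℝ} (hβ : 1 ≤ β) (hz0 : 0 ≤ z) (hlam0 : 0 ≤ lam)
    (hlam : (2 * β - 1) * lam ≤ 1) (hV0 : 0 ≤ V) :
    0 ≤ (2 * (1 - β * lam) * V + z * lam * V ^ 2) / (2 - (2 * β - 1) * lam) := by
  have hD : 0 < 2 - (2 * β - 1) * lam := by linarith
  have hb : 0 ≤ 1 - β * lam := by nlinarith
  apply div_nonneg _ hD.le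
  have : 0 ≤ z * lam * V ^ 2 := by positivity
  nlinarith [mul_nonneg hb hV0]

/-- Above the share `1/(β+1)` a squaring lands below the universal cut `(2+z)/3`. -/
theorem Vsq_le_cut {β z lam V : ℝ} (hβ : 1 ≤ β) (hz0 : 0 ≤ z) (hz1 : z ≤ 1) (hlam0 : 0 ≤ lam)
    (hlam : (2 * β - 1) * lam ≤ 1) (hbig : 1 ≤ (β + 1) * lam) (hV0 : 0 ≤ V) (hV1 : V ≤ 1) :
    (2 * (1 - β * lam) * V + z * lam * V ^ 2) / (2 - (2 * β - 1) * lam) ≤ (2 + z) / 3 := by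
  have hD : 0 < 2 - (2 * β - 1) * lam := by linarith
  rw [div_le_div_iff₀ hD (by norm_num : (0:ℝ) < 3)]
  have hb : 0 ≤ 1 - β * lam := by nlinarith
  have h1 : 2 * (1 - β * lam) * V ≤ 2 * (1 - β * lam) := by nlinarith
  have h2 : z * lam * V ^ 2 ≤ z * lam := by
    have : V ^ 2 ≤ 1 := by nlinarith
    have hzl : 0 ≤ z * lam := mul_nonneg hz0 hlam0
    nlinarith
  -- 3(2(1−βλ) + zλ) ≤ (2+z)(2−(2β−1)λ)  ⟺  (1−z)(1 − (β+1)λ) ≤ 0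
  nlinarith [mul_nonneg (sub_nonneg.2 hz1) (sub_nonneg.2 hbig)]

/-! ## The potential's one-step inequalities -/

/-- **Base steps: replenishment is never cheaper than its damping.**  With
`λ' = λ + μ − (2β−1)λμ` and `V'λ' = μ(1−βλ) + λ(1−βμ)V + zλμV`:
`λ'(1 − V') ≥ λ(1 − (β−1)μ)(1 − V)`. -/
theorem base_step_key {β z lam μ V V' lam' : ℝ} (hz1 : z ≤ 1) (hlam0 : 0 ≤ lam) (hμ0 : 0 ≤ μ)
    (hV0 : 0 ≤ V)
    (hlam' : lam' = lam + μ - (2 * β - 1) * lam * μ)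
    (hV' : V' * lam' = μ * (1 - β * lam) + lam * (1 - β * μ) * V + z * lam * μ * V) :
    lam * (1 - (β - 1) * μ) * (1 - V) ≤ lam' * (1 - V') := by
  have : lam' * (1 - V') = lam' - V' * lam' := by ring
  rw [this, hV', hlam']
  have : 0 ≤ lam * μ * (V - z * V) := by
    apply mul_nonneg (mul_nonneg hlam0 hμ0); nlinarith
  nlinarith

/-- `log(1 + t) ≤ t`-type bound used for the base's own deviation:
`log(c·y + s) ≤ log c + log y + s/(c·y)` for `c, y > 0`, `s ≥ 0`. -/
theorem log_affine_le {c y s : ℝ} (hc : 0 < c) (hy : 0 < y) (hs : 0 ≤ s) :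
    Real.log (c * y + s) ≤ Real.log c + Real.log y + s / (c * y) := by
  have hcy : 0 < c * y := mul_pos hc hy
  have h1 : c * y + s = (c * y) * (1 + s / (c * y)) := by field_simp
  rw [h1, Real.log_mul hcy.ne' (by positivity), Real.log_mul hc.ne' hy.ne']
  have := Real.log_le_sub_one_of_pos (show 0 < 1 + s / (c * y) by positivity)
  linarith

/-! ## One step of the potential `Ψ = log y − κ_S log ℓ − log λ − γ log(1 − min(V, V†))` -/

/-- `κ_S · log 2 = log(4/3)` for `κ_S = log(4/3)/log 2 = log₂(4/3)`. -/
theorem kappaS_mul_log_two : Real.log (4 / 3) / Real.log 2 * Real.log 2 = Real.log (4 / 3) :=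
  div_mul_cancel₀ _ (Real.log_pos (by norm_num : (1:ℝ) < 2)).ne'

/-- `κ_S ≥ 0`. -/
theorem kappaS_nonneg : 0 ≤ Real.log (4 / 3) / Real.log 2 :=
  div_nonneg (Real.log_nonneg (by norm_num)) (Real.log_nonneg (by norm_num))

/-- **Squaring step.**  Under the squaring criterion and the cut-off conditions on `V†`, an
admissible squaring (`V' ≥ V_min`) does not increase the potential. -/
theorem square_step_potential {β z Vmin γ Vd lam V lam' V' y y' ℓ ℓ' : ℝ}
    (hβ : 1 < β) (hz0 : 0 ≤ z) (hz1 : z ≤ 1) (hγ0 : 0 < γ)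
    (hVd1 : Vd < 1) (hVd2 : (2 + z) / 3 ≤ Vd)
    (hVd3 : Real.log (2 * β / (2 * β - 1)) - Real.log (4 / 3) ≤
      γ * (Real.log ((1 - z) / 3) - Real.log (1 - Vd)))
    (hcrit : ∀ lam V : ℝ, 0 < lam → (2 * β - 1) * lam ≤ 1 → 0 ≤ V → V < 1 →
      Vmin ≤ (2 * (1 - β * lam) * V + z * lam * V ^ 2) / (2 - (2 * β - 1) * lam) →
      Real.log (2 * (1 - (β - 1) * lam) / (2 - (2 * β - 1) * lam)) - Real.log (4 / 3) ≤
        γ * (Real.log (1 - (2 * (1 - β * lam) * V + z * lam * V ^ 2) / (2 - (2 * β - 1) * lam))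
          - Real.log (1 - V)))
    (hl0 : 0 < lam) (hl1 : (2 * β - 1) * lam ≤ 1) (hv0 : 0 ≤ V) (hv1 : V ≤ 1) (hy : 0 < y)
    (hℓ : 0 < ℓ)
    (hlam' : lam' = 2 * lam - (2 * β - 1) * lam ^ 2)
    (hV' : V' = (2 * (1 - β * lam) * V + z * lam * V ^ 2) / (2 - (2 * β - 1) * lam))
    (hy' : y' = 2 * (1 - (β - 1) * lam) * y) (hℓ' : ℓ' = 2 * ℓ) (hfloor : Vmin ≤ V') :
    Real.log y' - Real.log (4 / 3) / Real.log 2 * Real.log ℓ' - Real.log lam'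
        - γ * Real.log (1 - min V' Vd) ≤
      Real.log y - Real.log (4 / 3) / Real.log 2 * Real.log ℓ - Real.log lam
        - γ * Real.log (1 - min V Vd) := by
  have hD : 0 < 2 - (2 * β - 1) * lam := by linarith
  have hc : 0 < 1 - (β - 1) * lam := by nlinarith
  have h2 : (0:ℝ) < 2 := by norm_num
  -- the three "free" terms
  have hy'eq : Real.log y' = Real.log 2 + Real.log (1 - (β - 1) * lam) + Real.log y := by
    rw [hy', Real.log_mul (by positivity) hy.ne', Real.log_mul h2.ne' hc.ne']
  have hℓ'eq : Real.log ℓ' = Real.log 2 + Real.log ℓ := by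
    rw [hℓ', Real.log_mul h2.ne' hℓ.ne']
  have hlam'eq : Real.log lam' = Real.log lam + Real.log (2 - (2 * β - 1) * lam) := by
    rw [hlam', show 2 * lam - (2 * β - 1) * lam ^ 2 = lam * (2 - (2 * β - 1) * lam) by ring,
      Real.log_mul hl0.ne' hD.ne']
  have hE : Real.log (2 * (1 - (β - 1) * lam) / (2 - (2 * β - 1) * lam)) =
      Real.log 2 + Real.log (1 - (β - 1) * lam) - Real.log (2 - (2 * β - 1) * lam) := by
    rw [Real.log_div (by positivity) hD.ne', Real.log_mul h2.ne' hc.ne']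
  have hκ := kappaS_mul_log_two
  -- V' facts
  have hV'le : V' ≤ V := by rw [hV']; exact Vsq_le hz1 hl0.le hl1 hv0 hv1
  have hV'0 : 0 ≤ V' := by rw [hV']; exact Vsq_nonneg hβ.le hz0 hl0.le hl1 hv0
  have hz1' : z < 1 := by linarith
  -- gain bounds
  have hgainG : Real.log (2 * (1 - (β - 1) * lam) / (2 - (2 * β - 1) * lam)) ≤
      Real.log (2 * β / (2 * β - 1)) :=
    Real.log_le_log (by positivity) (gain_le_corner hβ hl1)
  have hmin_mono : 1 - min V Vd ≤ 1 - min V' Vd := by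
    have : min V' Vd ≤ min V Vd := min_le_min hV'le le_rfl
    linarith
  have hminpos : 0 < 1 - min V Vd := by
    have : min V Vd ≤ Vd := min_le_right _ _
    linarith
  have hlogmin : Real.log (1 - min V Vd) ≤ Real.log (1 - min V' Vd) :=
    Real.log_le_log hminpos hmin_mono
  by_cases hsmall : (β + 1) * lam ≤ 1
  · -- no gain below the share 1/(β+1)
    have hgain0 : Real.log (2 * (1 - (β - 1) * lam) / (2 - (2 * β - 1) * lam)) ≤
        Real.log (4 / 3) :=
      Real.log_le_log (by positivity) (gain_le_four_thirds hl1 hsmall)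
    rw [hE] at hgain0
    have e1 := mul_le_mul_of_nonneg_left hlogmin hγ0.le
    rw [hy'eq, hℓ'eq, hlam'eq, mul_add]
    linarith
  · have hbig : 1 ≤ (β + 1) * lam := (not_le.mp hsmall).le
    by_cases hVlt : V < Vd
    · -- the criterion pays
      have hminV : min V Vd = V := min_eq_left hVlt.le
      have hminV' : min V' Vd = V' := min_eq_left (hV'le.trans hVlt.le)
      have hc' := hcrit lam V hl0 hl1 hv0 (hVlt.trans hVd1) (by rw [hV'] at hfloor; exact hfloor)
      rw [← hV', hE] at hc'
      rw [hy'eq, hℓ'eq, hlam'eq, mul_add, hminV, hminV']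
      linarith
    · -- a high-narrowness squaring lands below the cut and pays at least G
      have hVge : Vd ≤ V := not_lt.mp hVlt
      have hminV : min V Vd = Vd := min_eq_right hVge
      have hcut : V' ≤ (2 + z) / 3 := by
        rw [hV']; exact Vsq_le_cut hβ.le hz0 hz1 hl0.le hl1 hbig hv0 hv1
      have hminV' : min V' Vd = V' := min_eq_left (hcut.trans hVd2)
      have hlogV' : Real.log ((1 - z) / 3) ≤ Real.log (1 - V') :=
        Real.log_le_log (div_pos (by linarith) (by norm_num)) (by linarith)
      have e1 := mul_le_mul_of_nonneg_left hlogV' hγ0.le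
      rw [hE] at hgainG
      rw [hy'eq, hℓ'eq, hlam'eq, mul_add, hminV, hminV']
      linarith

set_option maxHeartbeats 400000 in
/-- **Base step.**  Multiplying by a heavy base (share `μ ≤ 1/(2β−1)`, own deviation `≤ R·μ`)
does not increase the potential once the current deviation is at least
`Y₀ = R(2β−1)/(β(1−γ)(β−1))`. -/
theorem base_step_potential {β z γ Vd R lam μ V lam' V' y y' yb ℓ ℓ' : ℝ}
    (hβ : 1 < β) (hz1 : z ≤ 1) (hγ0 : 0 < γ) (hγ1 : γ < 1) (hVd1 : Vd < 1)
    (hl0 : 0 < lam) (hl1 : (2 * β - 1) * lam ≤ 1) (hm0 : 0 < μ) (hm1 : (2 * β - 1) * μ ≤ 1)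
    (hv0 : 0 ≤ V) (hy : 0 < y) (hℓ : 0 < ℓ)
    (hlam' : lam' = lam + μ - (2 * β - 1) * lam * μ)
    (hV' : V' * lam' = μ * (1 - β * lam) + lam * (1 - β * μ) * V + z * lam * μ * V)
    (hy' : y' = (1 - (β - 1) * μ) * y + (1 - (β - 1) * lam) * yb)
    (hyb0 : 0 ≤ yb) (hyb1 : yb ≤ R * μ) (hℓ' : ℓ ≤ ℓ')
    (hbig : R * (2 * β - 1) / (β * (1 - γ) * (β - 1)) ≤ y) :
    Real.log y' - Real.log (4 / 3) / Real.log 2 * Real.log ℓ' - Real.log lam'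
        - γ * Real.log (1 - min V' Vd) ≤
      Real.log y - Real.log (4 / 3) / Real.log 2 * Real.log ℓ - Real.log lam
        - γ * Real.log (1 - min V Vd) := by
  have hcμ : 0 < 1 - (β - 1) * μ := by nlinarith
  have hcμ1 : 1 - (β - 1) * μ ≤ 1 := by nlinarith
  have hcμlo : β / (2 * β - 1) ≤ 1 - (β - 1) * μ := by
    rw [div_le_iff₀ (by linarith : (0:ℝ) < 2 * β - 1)]; nlinarith
  have hc : 0 ≤ 1 - (β - 1) * lam := by nlinarith
  have hc1 : 1 - (β - 1) * lam ≤ 1 := by nlinarith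
  -- share grows
  have hlam'ge : lam ≤ lam' := by rw [hlam']; nlinarith [mul_nonneg hm0.le (sub_nonneg.2 hl1)]
  have hlam'pos : 0 < lam' := lt_of_lt_of_le hl0 hlam'ge
  have hloglam : Real.log lam ≤ Real.log lam' := Real.log_le_log hl0 hlam'ge
  -- deviation term
  have hy'le : y' ≤ (1 - (β - 1) * μ) * y + yb := by
    rw [hy']; nlinarith [mul_le_of_le_one_left hyb0 hc1]
  have hy'pos : 0 < y' := by
    rw [hy']; nlinarith [mul_pos hcμ hy, mul_nonneg hc hyb0]
  have hlogy : Real.log y' ≤ Real.log (1 - (β - 1) * μ) + Real.log y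
      + yb / ((1 - (β - 1) * μ) * y) :=
    (Real.log_le_log hy'pos hy'le).trans (log_affine_le hcμ hy hyb0)
  -- the source is absorbed once y ≥ Y₀
  have hγ' : 0 < 1 - γ := by linarith
  have hsrc : yb / ((1 - (β - 1) * μ) * y) ≤ (1 - γ) * (β - 1) * μ := by
    rw [div_le_iff₀ (mul_pos hcμ hy)]
    have hden : 0 < β * (1 - γ) * (β - 1) :=
      mul_pos (mul_pos (by linarith) hγ') (by linarith)
    have hb1 : R * (2 * β - 1) ≤ β * (1 - γ) * (β - 1) * y := by
      rw [div_le_iff₀ hden] at hbig; linarith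
    have hb2 : β ≤ (1 - (β - 1) * μ) * (2 * β - 1) := by
      rw [div_le_iff₀ (by linarith : (0:ℝ) < 2 * β - 1)] at hcμlo; linarith
    have hK : 0 ≤ (1 - γ) * (β - 1) * y := by
      have := mul_pos (mul_pos hγ' (by linarith : (0:ℝ) < β - 1)) hy; exact this.le
    have hb3 : R * (2 * β - 1) ≤ (1 - γ) * (β - 1) * y * (1 - (β - 1) * μ) * (2 * β - 1) := by
      have := mul_le_mul_of_nonneg_left hb2 hK
      linarith
    have hb4 : R ≤ (1 - γ) * (β - 1) * y * (1 - (β - 1) * μ) :=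
      le_of_mul_le_mul_right hb3 (by linarith)
    have hb5 := mul_le_mul_of_nonneg_right hb4 hm0.le
    linarith
  have hlogc : Real.log (1 - (β - 1) * μ) ≤ -((β - 1) * μ) := by
    have := Real.log_le_sub_one_of_pos hcμ; linarith
  have hlogc0 : Real.log (1 - (β - 1) * μ) ≤ 0 := by linarith [mul_pos (by linarith : 0 < β - 1) hm0]
  -- size term
  have hlogℓ : Real.log ℓ ≤ Real.log ℓ' := Real.log_le_log hℓ hℓ'
  have hκℓ : Real.log (4 / 3) / Real.log 2 * Real.log ℓ ≤ Real.log (4 / 3) / Real.log 2 * Real.log ℓ' :=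
    mul_le_mul_of_nonneg_left hlogℓ kappaS_nonneg
  -- narrowness term : −log(1−min V' Vd) + log(1−min V Vd) ≤ log lam' − log lam − log cμ
  have hh : Real.log (1 - min V Vd) - Real.log (1 - min V' Vd) ≤
      Real.log lam' - Real.log lam - Real.log (1 - (β - 1) * μ) := by
    have hkey := base_step_key (β := β) hz1 hl0.le hm0.le hv0 hlam' hV'
    by_cases hVlt : V < Vd
    · have hminV : min V Vd = V := min_eq_left hVlt.le
      have h1V : 0 < 1 - V := by linarith
      have hprodpos : 0 < lam * (1 - (β - 1) * μ) * (1 - V) := by positivity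
      have h1V' : 0 < 1 - V' := by
        have : 0 < lam' * (1 - V') := lt_of_lt_of_le hprodpos hkey
        rcases lt_or_ge 0 (1 - V') with hpos | hnonpos
        · exact hpos
        · exfalso
          have : lam' * (1 - V') ≤ 0 := mul_nonpos_of_nonneg_of_nonpos hlam'pos.le hnonpos
          linarith
      have hminle : Real.log (1 - V') ≤ Real.log (1 - min V' Vd) :=
        Real.log_le_log h1V' (by linarith [min_le_left V' Vd])
      have hlogkey := Real.log_le_log hprodpos hkey
      rw [Real.log_mul (by positivity) h1V.ne', Real.log_mul hl0.ne' hcμ.ne',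
        Real.log_mul hlam'pos.ne' h1V'.ne'] at hlogkey
      rw [hminV]; linarith
    · have hVge : Vd ≤ V := not_lt.mp hVlt
      have hminV : min V Vd = Vd := min_eq_right hVge
      have hminle : Real.log (1 - Vd) ≤ Real.log (1 - min V' Vd) :=
        Real.log_le_log (by linarith) (by linarith [min_le_right V' Vd])
      rw [hminV]; linarith
  -- assemble: ΔΨ ≤ (1−γ) log cμ + source − (1−γ)(log lam' − log lam) ≤ 0
  have e1 := mul_le_mul_of_nonneg_left hh hγ0.le
  have e2 := mul_le_mul_of_nonneg_left hlogc hγ'.le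
  have e3 := mul_le_mul_of_nonneg_left hloglam hγ'.le
  linarith


end Summit.MatrixMultiplication.MatrixMultiplication.Theorems.FarEdgeDescentChainCapSteps
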